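import Mathlib
import Literature.AlgebraicGeometry.Resolution.CobordantChartCoefficients

/-!
# Point blow-ups of plane curve germs: the two charts of the first neighbourhood, transforms, normal crossings

Vocabulary (definitions only, with their immediate unfolding lemmas) for the classical theory of
infinitely near points of a plane curve germ `b ∈ k[[x, y]]` (`x = X 0`, `y = X 1`, `k` a field):
Casas-Alvero, *Singularities of Plane Curves*, §3.1–3.2 (blowing up a point; the first
neighbourhood; the charts `x = x̄, y = x̄ ȳ` and `x = x̄ ȳ, y = ȳ`; strict and total transforms);
Hartshorne, *Algebraic Geometry*, V.3 (monoidal transformations, embedded resolution V.3.9);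
Campillo, *Algebroid curves in positive characteristic*, LNM 813, Ch. III.  Written for the named
fact `PlaneGermNonNCCount` (file `PlaneGermNonNCCount.lean`: finiteness of the tree of
non-normal-crossing infinitely near points) and its proof, in the vocabulary of
`Mathlib.RingTheory.MvPowerSeries.Substitution`:

* `PlaneGerm.IsNC b` — the SUPPORT of `b` is a normal crossing at the origin: in some formal
  coordinates `b∘Φ = u · x^a · y^c` with `u` a unit (verbatim the clause of `PlaneGermNonNCCount`).
* `PlaneGerm.dirChart t = (x, x(t + y))` — the point blow-up read at the point of the exceptional
  line with slope `t`; `PlaneGerm.vertChart = (x y, x)` — read at the vertical point (in both, the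
  exceptional line is `x = 0`).  Up to the scalings `PlaneGerm.diagScale α β = (α x, β y)` these are
  the weight-`(1,1)` cobordant chart `CobordantChart.chart 1 c` followed by the coordinate slice of
  the local resolution game (see `PlaneGermNonNCCount.lean`).
* `PlaneGerm.IsTransform Φ b D` — `b∘Φ = x^{ord b} · st` and `D = x · st`: `D` is the germ of the
  REDUCED TOTAL TRANSFORM (exceptional line times strict transform) at that point of the first
  neighbourhood; `PlaneGerm.IsSuccessor b D` — `D` is such a germ at some point (finite slope or
  vertical); `PlaneGerm.IsBadStep b D` — moreover `b ≠ 0` and the support of `b` is NOT a normal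
  crossing: the edges of the tree of non-normal-crossing infinitely near points, whose finiteness is
  the strong embedded resolution of plane curve germs.

Deliberately NOT here: any theorem about these notions beyond definitional unfolding and
substitutability (the calculus of transforms is developed where it is proved).
-/

namespace Literature.AlgebraicGeometry.Resolution.PlaneGerm

open MvPowerSeries

variable {k : Type*} [Field k]

/-- NORMAL-CROSSING SUPPORT: in some formal coordinates `Φ` (constant-free, invertible linear part)
`b∘Φ = u · x^a · y^c` with `u(0) ≠ 0` — the support of `b` is empty, one smooth branch, or two
transversal smooth branches (Casas-Alvero §3.7; the clause of `PlaneGermNonNCCount`). [cite: Hartshorne1977, V.3.9] -/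
def IsNC (b : MvPowerSeries (Fin 2) k) : Prop :=
  ∃ (Φ : Fin 2 → MvPowerSeries (Fin 2) k) (u : MvPowerSeries (Fin 2) k) (a c : ℕ),
    (∀ i, MvPowerSeries.constantCoeff (Φ i) = 0) ∧
    IsUnit (Matrix.det (Matrix.of fun i j => MvPowerSeries.coeff (Finsupp.single j 1) (Φ i))) ∧
    MvPowerSeries.constantCoeff u ≠ 0 ∧
    MvPowerSeries.subst Φ b = u * MvPowerSeries.X 0 ^ a * MvPowerSeries.X 1 ^ c

/-- `IsNC` unfolded. [folklore] -/
theorem isNC_iff (b : MvPowerSeries (Fin 2) k) :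
    IsNC b ↔ ∃ (Φ : Fin 2 → MvPowerSeries (Fin 2) k) (u : MvPowerSeries (Fin 2) k) (a c : ℕ),
      (∀ i, MvPowerSeries.constantCoeff (Φ i) = 0) ∧
      IsUnit (Matrix.det (Matrix.of fun i j => MvPowerSeries.coeff (Finsupp.single j 1) (Φ i))) ∧
      MvPowerSeries.constantCoeff u ≠ 0 ∧
      MvPowerSeries.subst Φ b = u * MvPowerSeries.X 0 ^ a * MvPowerSeries.X 1 ^ c :=
  Iff.rfl

/-- The point blow-up in the chart of the exceptional point of finite slope `t`:
`x ↦ x`, `y ↦ x (t + y)` (Casas-Alvero §3.2, `x = x̄`, `y = x̄(t + ȳ)`). [folklore] -/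
noncomputable def dirChart (t : k) : Fin 2 → MvPowerSeries (Fin 2) k :=
  ![MvPowerSeries.X 0, MvPowerSeries.X 0 * (MvPowerSeries.C t + MvPowerSeries.X 1)]

variable (k) in
/-- The point blow-up in the chart of the vertical exceptional point: `x ↦ x y`, `y ↦ x`
(the exceptional line is again `x = 0`). [folklore] -/
noncomputable def vertChart : Fin 2 → MvPowerSeries (Fin 2) k :=
  ![MvPowerSeries.X 0 * MvPowerSeries.X 1, MvPowerSeries.X 0]

/-- The diagonal scaling `x ↦ α x`, `y ↦ β y`. [folklore] -/
noncomputable def diagScale (α β : k) : Fin 2 → MvPowerSeries (Fin 2) k :=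
  ![MvPowerSeries.C α * MvPowerSeries.X 0, MvPowerSeries.C β * MvPowerSeries.X 1]

/-- Value of the chart. [folklore] -/
@[simp] theorem dirChart_zero (t : k) : dirChart t 0 = MvPowerSeries.X 0 := rfl

/-- Value of the chart. [folklore] -/
@[simp] theorem dirChart_one (t : k) :
    dirChart t 1 = MvPowerSeries.X 0 * (MvPowerSeries.C t + MvPowerSeries.X 1) := rfl

/-- Value of the chart. [folklore] -/
@[simp] theorem vertChart_zero : vertChart k 0 = MvPowerSeries.X 0 * MvPowerSeries.X 1 := rfl

/-- Value of the chart. [folklore] -/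
@[simp] theorem vertChart_one : vertChart k 1 = MvPowerSeries.X 0 := rfl

/-- Value of the scaling. [folklore] -/
@[simp] theorem diagScale_zero (α β : k) : diagScale α β 0 = MvPowerSeries.C α * MvPowerSeries.X 0 := rfl

/-- Value of the scaling. [folklore] -/
@[simp] theorem diagScale_one (α β : k) : diagScale α β 1 = MvPowerSeries.C β * MvPowerSeries.X 1 := rfl

/-- The charts and scalings are constant-free. [folklore] -/
theorem constantCoeff_dirChart (t : k) (i : Fin 2) : MvPowerSeries.constantCoeff (dirChart t i) = 0 := by
  fin_cases i <;> simp [MvPowerSeries.constantCoeff_X]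

/-- The charts and scalings are constant-free. [folklore] -/
theorem constantCoeff_vertChart (i : Fin 2) : MvPowerSeries.constantCoeff (vertChart k i) = 0 := by
  fin_cases i <;> simp [MvPowerSeries.constantCoeff_X]

/-- The charts and scalings are constant-free. [folklore] -/
theorem constantCoeff_diagScale (α β : k) (i : Fin 2) :
    MvPowerSeries.constantCoeff (diagScale α β i) = 0 := by
  fin_cases i <;> simp [MvPowerSeries.constantCoeff_X]

/-- Hence substitutable. [folklore] -/
theorem hasSubst_dirChart (t : k) : MvPowerSeries.HasSubst (dirChart t) :=
  MvPowerSeries.hasSubst_of_constantCoeff_zero (constantCoeff_dirChart t)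

/-- Hence substitutable. [folklore] -/
theorem hasSubst_vertChart : MvPowerSeries.HasSubst (vertChart k) :=
  MvPowerSeries.hasSubst_of_constantCoeff_zero constantCoeff_vertChart

/-- Hence substitutable. [folklore] -/
theorem hasSubst_diagScale (α β : k) : MvPowerSeries.HasSubst (diagScale α β) :=
  MvPowerSeries.hasSubst_of_constantCoeff_zero (constantCoeff_diagScale α β)

/-- `D` is the REDUCED TOTAL TRANSFORM GERM of `b` in the chart `Φ`: `b∘Φ = x^{ord b} · st` (the
exceptional line `x = 0` splits off with multiplicity `ord b`) and `D = x · st` (exceptional line times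
strict transform; Casas-Alvero §3.2, total/strict transform). [folklore] -/
def IsTransform (Φ : Fin 2 → MvPowerSeries (Fin 2) k) (b D : MvPowerSeries (Fin 2) k) : Prop :=
  ∃ (m : ℕ) (st : MvPowerSeries (Fin 2) k), b.order = m ∧
    MvPowerSeries.subst Φ b = MvPowerSeries.X 0 ^ m * st ∧ D = MvPowerSeries.X 0 * st

/-- `IsTransform` unfolded. [folklore] -/
theorem isTransform_iff (Φ : Fin 2 → MvPowerSeries (Fin 2) k) (b D : MvPowerSeries (Fin 2) k) :
    IsTransform Φ b D ↔ ∃ (m : ℕ) (st : MvPowerSeries (Fin 2) k), b.order = m ∧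
      MvPowerSeries.subst Φ b = MvPowerSeries.X 0 ^ m * st ∧ D = MvPowerSeries.X 0 * st :=
  Iff.rfl

/-- `D` is the reduced total transform germ of `b` at SOME point of the first neighbourhood (finite
slope or vertical). [folklore] -/
def IsSuccessor (b D : MvPowerSeries (Fin 2) k) : Prop :=
  (∃ t : k, IsTransform (dirChart t) b D) ∨ IsTransform (vertChart k) b D

/-- `IsSuccessor` unfolded. [folklore] -/
theorem isSuccessor_iff (b D : MvPowerSeries (Fin 2) k) :
    IsSuccessor b D ↔ (∃ t : k, IsTransform (dirChart t) b D) ∨ IsTransform (vertChart k) b D :=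
  Iff.rfl

/-- An EDGE OF THE TREE of non-normal-crossing infinitely near points: `b ≠ 0`, the support of `b` is
not a normal crossing, and `D` is a first-neighbourhood germ of `b`.  Finiteness of all chains of such
edges is the strong embedded resolution of plane curve germs. [cite: Hartshorne1977, V.3.9] -/
def IsBadStep (b D : MvPowerSeries (Fin 2) k) : Prop :=
  b ≠ 0 ∧ ¬ IsNC b ∧ IsSuccessor b D

/-- `IsBadStep` unfolded. [folklore] -/
theorem isBadStep_iff (b D : MvPowerSeries (Fin 2) k) :
    IsBadStep b D ↔ b ≠ 0 ∧ ¬ IsNC b ∧ IsSuccessor b D :=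
  Iff.rfl

end Literature.AlgebraicGeometry.Resolution.PlaneGerm
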